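import Literature.NumberTheory.FaltingsSerre.Paramodular587minusHolds
import HarnessLib

/-!
# `N = 587` (conductor 587, Fricke sign `−`, LMFDB 587.a.587.1): `A⁻₅₈₇` is paramodular of level `587` away from `587` — summit-side headline
# (cell `pub-paramod`; certificate `certs/587/minus/certificate.canonical.json`, sha256 `3ecc7fdaad431fe1aa2cebdb3d9fd053bdbf5c23e813cbf52062eb7b084bc5cd`)

HONEST FRAMING: an INSTANCE theorem by a PUBLISHED method (the Faltings–Serre method as
Brumer–Pacetti–Poor–Tornaría–Voight–Yuen apply it); the cell's value is certified coverage of LMFDB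
genus-2 curves, NOT a new modularity theorem.  This pair is a RE-CERTIFICATION of the PRINTED theorem [BPPTVY, Thm 7.3.1 p. 1191] (check set = the printed (7.3.3); `λ_p(f⁻₅₈₇)` by four code-disjoint engines; residual identification of record by Route E, cross-checked by the printed `Q₃`, `Q₁₁ mod 2` route; referee R103 Audit 151 'reproduction').

[BPPTVY] = A. Brumer, A. Pacetti, C. Poor, G. Tornaría, J. Voight, D. S. Yuen, *On the paramodularity of
typical abelian surfaces*, Algebra & Number Theory **13**:5 (2019) 1145–1195 [cite: BrumerEtAl2019]
(criterion Thm 2.1.5 p. 1150 / Alg 2.4.1 p. 1155; form-side Galois representation Thm 4.3.4 p. 1169;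
shape of the conclusion Thm 7.1.3 p. 1187).  [PY15] = C. Poor, D. S. Yuen, *Paramodular cusp forms*,
Math. Comp. **84** (2015) 1401–1438 [cite: PoorYuen2015].  [PSY20] = C. Poor, J. Shurman, D. S. Yuen,
*Nonlift weight two paramodular eigenform constructions*, J. Korean Math. Soc. **57** (2020) 507–522
[cite: PoorShurmanYuen2020].  [BK14] = A. Brumer, K. Kramer, *Paramodular abelian varieties of odd
conductor*, Trans. Amer. Math. Soc. **366** (2014) 2463–2516 [cite: BrumerKramer2014].

THE PAIR.  `A⁻₅₈₇ = Jac(C)`, `C⁻ : y² + (x³+x+1)y = −x²−x`, isogeny class 587⁻ = LMFDB `587.a.587.1` (root number `−1`; [BK14, Table 2 p. 2512] row 587b); `f⁻₅₈₇` = the weight-2 paramodular NONLIFT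
Hecke eigenform of level `587` with rational eigenvalues [BPPTVY, (6.2.8)–(6.2.10) p. 1180; PY15, Thm 1.1 p. 1402, Table 5 p. 1433; GritsenkoPoorYuen2020].  Residual image of `ρ̄_{A,2}`:
`S₆`; check primes `P = {3, 5, 7, 11, 13, 17, 19, 23, 29, 37, 41}`; trace table `a_p(A⁻₅₈₇) = a_p(f⁻₅₈₇)` on `P`: `−4, −2, 0, −1, −2, 0, −7, −5, 5, −4, 1` — every
load-bearing datum of the certificate by TWO independent implementations that agree (cell rule).

WHAT THIS FILE IS (placement).  The SUMMIT-SIDE HOME of the headline — the brief's TARGET path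
`lean/Summits/Langlands/Paramodular/<N>.lean` (human LEAN PLACEMENT RULE of 2026-08-19: new work under
`Summits/<Summit>/<cell topic>/`; cell topic `Langlands/Paramodular` registered 2026-08-20).  It is
deprecate-and-add STEP 1 ("add"): the statement below is LITERALLY the criterion-free instance statement
of `Literature.NumberTheory.FaltingsSerre.Paramodular587minus.paramodular_587minus_holds`
(`Literature/NumberTheory/FaltingsSerre/Paramodular587minusHolds.lean`, p215409) and is PROVED BY that theorem; nothing under `Literature/`
is edited or moved by this file (the rule forbids self-moves; the import-safe migration of the bodies is
the gate's, cell record `pub-paramod-lit/LEAN-PLACEMENT-AUDIT-g16.md` §4 — the cell's import cone is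
closed, so re-pointing is internal).  The instance with the criterion as a binder is
`Literature.NumberTheory.FaltingsSerre.Paramodular587minus.paramodular_587minus` (Paramodular587minus.lean, p215182);
the criterion [BPPTVY, Thm 2.1.5 / Alg 2.4.1] is a KERNEL THEOREM
(`Literature.NumberTheory.FaltingsSerre.traceEq_of_faltingsSerre_symplectic_holds`, `CriterionProofs.lean`, p181742), which is why it
is no longer a hypothesis here.

WHAT IS HYPOTHESIS AND WHAT IS PROVED.  Binders (exactly those of the Literature theorem): the
CERTIFICATE `hC : Paramodular587minus.Certificate587minus J ν ρA ρf` — the `Prop` that the computed data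
discharge the criterion's inputs for (`ρA`, `ρf`); it is discharged OUTSIDE the kernel by the frozen,
twice-computed certificate file `certs/587/minus/certificate.canonical.json` (canonical sha256
`3ecc7fdaad431fe1aa2cebdb3d9fd053bdbf5c23e813cbf52062eb7b084bc5cd`; ABSOLUTE RULE of the cell: a certificate is a
binder, never a Literature fact); the `A`-side frame and good Euler factors `hframe`, `hA` (surface shape
`1 − aT + bT² − paT³ + p²T⁴`); the form-side `2`-adic representation `hρf` = [BPPTVY, Thm 4.3.4 p. 1169]
(ARTHUR-DEPENDENT via Mok 2014 — an input, flagged by the referee, protocol A7); the form data `hcusp`,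
`hne`, `hfe`; and the coefficientwise check at `p = 2 = ℓ` (certificate data, cell DIVERGENCE.md D-4).
CONCLUSION `IsParamodularAwayFrom A 587 f`: `f` is a nonzero weight-2 paramodular cusp form of level `587`
and `L_p(A,T) = Q_p(f,T)` for EVERY prime `p ≠ 587` (the Euler factor AT `587` is not certified, D-4;
nothing here says "modular (GL₄)", referee S3).  `#print axioms` of both theorems below ⊆
{propext, Classical.choice, Quot.sound} (inherited from the Literature proof; gate axiom audit).
-/

noncomputable section

namespace Summit.Langlands.Paramodular

open Polynomial IsDedekindDomain
open Literature.NumberTheory.FaltingsSerre Literature.NumberTheory.GaloisRepresentations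
  Literature.NumberTheory.Automorphic.Paramodular Literature.NumberTheory.Automorphic
  Literature.AlgebraicGeometry.Motives
open scoped NumberField

/-- **`A⁻₅₈₇` (587.a.587.1) is paramodular of level `587` away from `587`, with partner `f⁻₅₈₇`** —
summit-side headline; statement = the criterion-free instance statement, proof =
`Literature.NumberTheory.FaltingsSerre.Paramodular587minus.paramodular_587minus_holds`.  From the frozen certificate `hC`
(sha256 `3ecc7fdaad43…`), the `A`-side frame/Euler data, the cited
`ρ_{f,2}` [BPPTVY, Thm 4.3.4] and the form data: `IsParamodularAwayFrom A 587 f`.  Re-certification of a PRINTED theorem.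
[cite: BrumerEtAl2019, Thm 7.3.1 p. 1191; Thm 2.1.5 p. 1150; Alg 2.4.1 p. 1155; Thm 4.3.4 p. 1169; PoorYuen2015, Table 5 p. 1433; GritsenkoPoorYuen2020] -/
theorem paramodular_587minus
    {A : AbelianVariety ℚ} {f : Matrix (Fin 2) (Fin 2) ℂ → ℂ}
    {ρA ρf : FramedGaloisRep ℚ ℤ_[2] 4} {J : Matrix (Fin 4) (Fin 4) ℤ_[2]}
    {ν : Field.absoluteGaloisGroup ℚ → ℤ_[2]}
    {b : Module.Basis (Fin 4) ℚ_[2] (A.rationalTateModule 2)}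
    (hC : Paramodular587minus.Certificate587minus J ν ρA ρf)
    (hframe : A.IsFrameOfTateRep 2 b (rationalize ρA))
    (aA bA af bf : ℕ → ℤ)
    (hA : ∀ p : ℕ, p.Prime → ¬ p ∣ 587 →
      A.HasGoodEulerFactorAt p ((lPolynomialOfSurface p (aA p) (bA p)).map (Int.castRingHom ℚ)))
    (hρf : ∀ p : ℕ, p.Prime → ¬ p ∣ 587 → p ≠ 2 →
      ∀ v : HeightOneSpectrum (𝓞 ℚ), ((p : ℕ) : 𝓞 ℚ) ∈ v.asIdeal →
        ρf.HasFrobCharpolyAt v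
          ((lPolynomialOfSurface p (af p) (bf p)).reverse.map (Int.castRingHom ℤ_[2])))
    (hcusp : IsParamodularCuspForm 587 2 f) (hne : ∃ Z ∈ siegelUpperHalfSpace 2, f Z ≠ 0)
    (hfe : ∀ p : ℕ, p.Prime → ¬ p ∣ 587 →
      HasSpinorEulerFactorAt 2 p f ((lPolynomialOfSurface p (af p) (bf p)).map (Int.castRingHom ℂ)))
    (h2A : aA 2 = -3 ∧ bA 2 = 5) (h2f : af 2 = -3 ∧ bf 2 = 5) :
    IsParamodularAwayFrom A 587 f :=
  Literature.NumberTheory.FaltingsSerre.Paramodular587minus.paramodular_587minus_holds hC hframe aA bA af bf hA hρf hcusp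
    hne hfe h2A h2f

/-- The conclusion unfolded at one prime `p ≠ 587`: ONE polynomial `Q ∈ ℚ[T]` is both the spinor Euler
factor `Q_p(f⁻₅₈₇,T)` and the good Euler factor `L_p(A⁻₅₈₇,T)`. [cite: BrumerEtAl2019, Thm 7.3.1 p. 1191] -/
theorem eulerFactors_agree_587minus
    {A : AbelianVariety ℚ} {f : Matrix (Fin 2) (Fin 2) ℂ → ℂ}
    {ρA ρf : FramedGaloisRep ℚ ℤ_[2] 4} {J : Matrix (Fin 4) (Fin 4) ℤ_[2]}
    {ν : Field.absoluteGaloisGroup ℚ → ℤ_[2]}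
    {b : Module.Basis (Fin 4) ℚ_[2] (A.rationalTateModule 2)}
    (hC : Paramodular587minus.Certificate587minus J ν ρA ρf)
    (hframe : A.IsFrameOfTateRep 2 b (rationalize ρA))
    (aA bA af bf : ℕ → ℤ)
    (hA : ∀ p : ℕ, p.Prime → ¬ p ∣ 587 →
      A.HasGoodEulerFactorAt p ((lPolynomialOfSurface p (aA p) (bA p)).map (Int.castRingHom ℚ)))
    (hρf : ∀ p : ℕ, p.Prime → ¬ p ∣ 587 → p ≠ 2 →
      ∀ v : HeightOneSpectrum (𝓞 ℚ), ((p : ℕ) : 𝓞 ℚ) ∈ v.asIdeal →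
        ρf.HasFrobCharpolyAt v
          ((lPolynomialOfSurface p (af p) (bf p)).reverse.map (Int.castRingHom ℤ_[2])))
    (hcusp : IsParamodularCuspForm 587 2 f) (hne : ∃ Z ∈ siegelUpperHalfSpace 2, f Z ≠ 0)
    (hfe : ∀ p : ℕ, p.Prime → ¬ p ∣ 587 →
      HasSpinorEulerFactorAt 2 p f ((lPolynomialOfSurface p (af p) (bf p)).map (Int.castRingHom ℂ)))
    (h2A : aA 2 = -3 ∧ bA 2 = 5) (h2f : af 2 = -3 ∧ bf 2 = 5) {p : ℕ} (hp : p.Prime) (hpN : p ≠ 587) :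
    ∃ Q : Polynomial ℚ, HasSpinorEulerFactorAt 2 p f (Q.map (algebraMap ℚ ℂ)) ∧
      A.HasGoodEulerFactorAt p Q :=
  Literature.NumberTheory.FaltingsSerre.Paramodular587plus.eulerFactors_agree_587plus
    (paramodular_587minus hC hframe aA bA af bf hA hρf hcusp hne hfe h2A h2f) hp hpN

end Summit.Langlands.Paramodular

end
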